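import Mathlib

/-!
# Nilpotent pencils: which endomorphisms factor through a free `O[z]/(zⁿ⁺¹)`-module

`[OURS · L1 w44b · idea-2 g3]` — helper for the crux `HomologicalConductor.Persistence`
(stmt-ResolutionOfSingularities-16484): the certificate format behind card B3
(`stably-semisimple-cylinder-persistence`) and behind the ×line LOSS LAW of CRUX-PLAN v4 §2
(res-L1-w44b-tri-1 lemma T1-L3, res-L1-w44b-tri-2 JORDAN-CALIBRATION).  NOT a statement of the
manuscript.  The only printed input is the SHAPE of Higman's criterion for the Frobenius extension
`O ⊂ O[z]/(zⁿ⁺¹)` (relatively projective = image of the trace map) [cite: Higman1955,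
doi:10.4153/cjm-1955-052-4]; it is re-proved here from scratch, in coordinates.

## Setting (coordinates only, no quotient rings)

`O` is a commutative ring.  A module over `B := O[z]/(zⁿ⁺¹)` is encoded as an `O`-module `L` with an
`O`-linear endomorphism `Z` (the action of `z`; `Z ^ (n+1) = 0` makes it a `B`-module — most lemmas do
not even use that).  The free `B`-module on an `O`-module `F`, `B ⊗_O F = ⊕_{k ≤ n} zᵏF`, is
`Fin (n+1) → F` with the shift `shift O n` (`(shift v) 0 = 0`, `(shift v) (j+1) = v j`; `shift ^ (n+1) = 0`,
`shift_pow_eq_zero`).  A `B`-linear map `L → B ⊗ F` is an `O`-linear `S` with `S ∘ Z = shift ∘ S`; a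
`B`-linear map `B ⊗ F → L` is an `O`-linear `T` with `T ∘ shift = Z ∘ T`.  A projective `B`-module is a
`B`-summand of some `B ⊗ F`, so "factors through a projective" implies "factors through some `B ⊗ F`".

## Results

* `comp_eq_pencilSum` (Higman, "only if"): for every such pair `S, T` one has
  `T ∘ S = Σ_{k=0}^{n} Zᵏ ∘ σ ∘ Zⁿ⁻ᵏ = pencilSum n Z σ` with `σ = T(z⁰ ·) ∘ (S ·)ₙ`.
* `exists_factor_of_pencilSum` ("if"): if `Z ^ (n+1) = 0`, every pencil sum factors through
  `Fin (n+1) → L` (which is `B`-free when `L` is `O`-free, e.g. for lattices over a DVR `O`).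
* `pencilSum_smul_one` / `pow_eq_pencilSum_of_mul_eq_one` (calibration, KEPT): `pencilSum n Z (c • 1) =
  ((n+1) c) • Zⁿ`; so `zⁿ` — the Jacobian generator `∂_z zⁿ⁺¹` up to the factor `n+1` — is stably zero on
  every `B`-module as soon as `n+1` is invertible in `O`.
* `pencilSum_eq_pow` (KEPT without Euler): `σ Z = 0 ∧ Zᵐ σ = Zᵐ ⇒ pencilSum m Z σ = Zᵐ`; over a PID such a `σ`
  exists on every lattice (`σ = 1 - π`, `π` a projection onto the saturation of `im Z`), so `zᵐ` is KEPT in every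
  characteristic (paper remark in the docstring).
* `not_pencilSum_chain` / `chain_not_factor` (LOST, every rank at once): on the "unit chain"
  `M = O^(n+1)`, `Z = w • shift O n` (`Z eⱼ = w eⱼ₊₁`, `Z ^ (n+1) = 0`, so `M` is a module over
  `O[z]/(z^(n+2))` as well), the power `Zᵉ = wᵉ • shiftᵉ` (`e ≤ n`) is NOT a pencil sum for the exponent
  `n+1`, hence does not factor through any free `O[z]/(z^(n+2))`-module, whenever `wᵉ ∉ wⁿ⁺¹O` (e.g. `O`
  a domain, `w ≠ 0` a non-unit): every such pencil sum is divisible by `wⁿ⁺¹` (`pencilSum_smul`) while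
  `⟨eₑ*, Zᵉ e₀⟩ = wᵉ`.  With `m := n+1` this is the linear algebra of «`zᵉ·1` (`e ≤ m-1`) is not stably
  zero on the rank-`m` chain lattice over `O[z]/(z^(m+1))`»; after Knörrer periodicity (paper level, not
  used here; char ≠ 2) it reads «`z^(m-1) ∉ ca(A_m × line)` although `z^(m-1) ∈ ca(A_m)`, `m ≥ 2`», the
  A-rows of the loss law, previously machine-checked modulo `w⁶` for `m ≤ 6` only.

Nothing here is specific to resolution of singularities: it is the certificate format (a matrix `σ`, or
a divisibility obstruction) by which KEPT / LOST entries are decided at suspension (`xy = g`) stages.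
-/

-- single-problem summit: the doubled namespace component is forced
set_option linter.dupNamespace false

namespace Summit.ResolutionOfSingularities.ResolutionOfSingularities.Theorems.HomologicalConductor.PersistencePencil

open Finset

variable (O : Type*) [CommRing O]
variable {L : Type*} [AddCommGroup L] [Module O L]
variable {F : Type*} [AddCommGroup F] [Module O F]

/-! ## The free module `B ⊗_O F = (Fin (n+1) → F, shift)` -/

/-- The shift on `Fin (n+1) → F`: `(shift O n v) 0 = 0`, `(shift O n v) j.succ = v j.castSucc`
(multiplication by `z` on `⊕_{k ≤ n} zᵏ F`). -/
def shift (n : ℕ) : (Fin (n + 1) → F) →ₗ[O] (Fin (n + 1) → F) :=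
  LinearMap.pi fun i : Fin (n + 1) =>
    Fin.cases (motive := fun _ => (Fin (n + 1) → F) →ₗ[O] F) 0
      (fun j => LinearMap.proj (Fin.castSucc j)) i

variable {O}

/-- The `z⁰`-coordinate of `shift v` is `0`. -/
@[simp] theorem shift_apply_zero (n : ℕ) (v : Fin (n + 1) → F) :
    shift O n v 0 = 0 := by
  simp [shift]

/-- The `zʲ⁺¹`-coordinate of `shift v` is the `zʲ`-coordinate of `v`. -/
@[simp] theorem shift_apply_succ (n : ℕ) (v : Fin (n + 1) → F) (j : Fin n) :
    shift O n v j.succ = v j.castSucc := by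
  simp [shift]

/-- `z · (zʲ f) = zʲ⁺¹ f`: the shift moves a spike up by one. -/
theorem shift_single_castSucc (n : ℕ) (j : Fin n) (f : F) :
    shift O n (Pi.single (Fin.castSucc j) f) = Pi.single j.succ f := by
  funext i
  refine Fin.cases ?_ (fun i' => ?_) i
  · rw [shift_apply_zero, Pi.single_eq_of_ne (Fin.succ_ne_zero j).symm]
  · rw [shift_apply_succ]
    simp [Pi.single_apply, Fin.succ_inj, Fin.castSucc_inj]

/-- `zᵏ · (z⁰ f) = zᵏ f`. -/
theorem shift_pow_single_zero (n : ℕ) (k : Fin (n + 1)) (f : F) :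
    (shift O n ^ (k : ℕ)) (Pi.single 0 f) = Pi.single k f := by
  induction k using Fin.induction with
  | zero => simp
  | succ j ih =>
      rw [Fin.val_castSucc] at ih
      rw [Fin.val_succ, pow_succ', Module.End.mul_apply, ih, shift_single_castSucc]

/-- The coordinates below `j` of `shiftʲ v` vanish. -/
theorem shift_pow_apply_eq_zero (n : ℕ) :
    ∀ (j : ℕ) (v : Fin (n + 1) → F) (i : Fin (n + 1)), (i : ℕ) < j →
      (shift O n ^ j) v i = 0 := by
  intro j
  induction j with
  | zero => intro v i hi; exact absurd hi (Nat.not_lt_zero _)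
  | succ j ih =>
      intro v i
      rw [pow_succ', Module.End.mul_apply]
      refine Fin.cases ?_ (fun i' => ?_) i
      · intro; simp
      · intro hi'
        rw [shift_apply_succ]
        apply ih
        rw [Fin.val_castSucc]
        rw [Fin.val_succ] at hi'
        omega

/-- `z^(n+1) = 0` on `B ⊗ F`: the model is a module over `B = O[z]/(zⁿ⁺¹)`. -/
theorem shift_pow_eq_zero (n : ℕ) : (shift O n : Module.End O (Fin (n + 1) → F)) ^ (n + 1) = 0 := by
  apply LinearMap.ext
  intro v
  funext i
  rw [LinearMap.zero_apply]
  exact shift_pow_apply_eq_zero n (n + 1) v i i.isLt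

/-! ## Pencil sums -/

/-- The pencil sum `Σ_{k=0}^{n} Zᵏ ∘ σ ∘ Zⁿ⁻ᵏ` (Higman's trace of `σ` for the dual bases `zᵏ`, `zⁿ⁻ᵏ`). -/
def pencilSum (n : ℕ) (Z σ : Module.End O L) : Module.End O L :=
  ∑ k : Fin (n + 1), Z ^ (k : ℕ) * σ * Z ^ (n - k : ℕ)

/-- Pointwise form of `pencilSum`: `pencilSum n Z σ l = Σₖ Zᵏ (σ (Zⁿ⁻ᵏ l))`. -/
theorem pencilSum_apply (n : ℕ) (Z σ : Module.End O L) (l : L) :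
    pencilSum n Z σ l = ∑ k : Fin (n + 1), (Z ^ (k : ℕ)) (σ ((Z ^ (n - k : ℕ)) l)) := by
  simp [pencilSum, LinearMap.sum_apply, Module.End.mul_apply]

/-! ## Higman's criterion, "only if": whatever factors through `B ⊗ F` is a pencil sum -/

/-- The coordinates of a `B`-linear `S : L → B ⊗ F` are determined by the top one:
`(S l)ₖ = (S (Zⁿ⁻ᵏ l))ₙ`. -/
theorem apply_eq_apply_pow_last (n : ℕ) (Z : Module.End O L) (S : L →ₗ[O] (Fin (n + 1) → F))
    (hS : ∀ l, S (Z l) = shift O n (S l)) :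
    ∀ (k : Fin (n + 1)) (l : L), S l k = S ((Z ^ (n - k : ℕ)) l) (Fin.last n) := by
  intro k
  induction k using Fin.reverseInduction with
  | last => intro l; simp
  | cast j ih =>
      intro l
      have h1 : S l (Fin.castSucc j) = S (Z l) j.succ := by
        rw [hS, shift_apply_succ]
      rw [h1, ih (Z l), Fin.val_castSucc, Fin.val_succ]
      have h2 : n - (j : ℕ) = (n - ((j : ℕ) + 1)) + 1 := by
        have := j.isLt
        omega
      rw [h2, pow_succ, Module.End.mul_apply]

/-- A `B`-linear `T : B ⊗ F → L` is determined by `τ = T(z⁰ ·)`: `T (zᵏ f) = Zᵏ (τ f)`. -/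
theorem apply_single_eq_pow (n : ℕ) (Z : Module.End O L) (T : (Fin (n + 1) → F) →ₗ[O] L)
    (hT : ∀ v, T (shift O n v) = Z (T v)) :
    ∀ (k : Fin (n + 1)) (f : F), T (Pi.single k f) = (Z ^ (k : ℕ)) (T (Pi.single 0 f)) := by
  intro k
  induction k using Fin.induction with
  | zero => intro f; simp
  | succ j ih =>
      intro f
      rw [← shift_single_castSucc (O := O) n j f, hT, ih, Fin.val_succ, pow_succ',
        Module.End.mul_apply, Fin.val_castSucc]

/-- … hence `T v = Σₖ Zᵏ τ(vₖ)`. -/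
theorem apply_eq_sum_pow (n : ℕ) (Z : Module.End O L) (T : (Fin (n + 1) → F) →ₗ[O] L)
    (hT : ∀ v, T (shift O n v) = Z (T v)) (v : Fin (n + 1) → F) :
    T v = ∑ k : Fin (n + 1), (Z ^ (k : ℕ)) (T (Pi.single 0 (v k))) := by
  calc T v = T (∑ k : Fin (n + 1), Pi.single k (v k)) := by rw [Finset.univ_sum_single]
    _ = ∑ k : Fin (n + 1), T (Pi.single k (v k)) := map_sum T _ _
    _ = ∑ k : Fin (n + 1), (Z ^ (k : ℕ)) (T (Pi.single 0 (v k))) :=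
        Finset.sum_congr rfl (fun k _ => apply_single_eq_pow n Z T hT k (v k))

/-- **Higman's criterion for `O ⊂ O[z]/(zⁿ⁺¹)`, "only if".**  If an endomorphism of `(L, Z)` factors
`B`-linearly through the free module `B ⊗ F = (Fin (n+1) → F, shift)`, then it is the pencil sum of
`σ := T(z⁰ ·) ∘ (S ·)ₙ`. -/
theorem comp_eq_pencilSum (n : ℕ) (Z : Module.End O L) (S : L →ₗ[O] (Fin (n + 1) → F))
    (T : (Fin (n + 1) → F) →ₗ[O] L) (hS : ∀ l, S (Z l) = shift O n (S l))
    (hT : ∀ v, T (shift O n v) = Z (T v)) :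
    T ∘ₗ S = pencilSum n Z
      ((T ∘ₗ LinearMap.single O (fun _ : Fin (n + 1) => F) 0) ∘ₗ
        (LinearMap.proj (Fin.last n) ∘ₗ S)) := by
  apply LinearMap.ext
  intro l
  rw [LinearMap.comp_apply, pencilSum_apply, apply_eq_sum_pow n Z T hT (S l)]
  refine Finset.sum_congr rfl (fun k _ => ?_)
  rw [apply_eq_apply_pow_last n Z S hS k l]
  simp [LinearMap.comp_apply]

/-- Existential form: an endomorphism that factors through some `B ⊗ F` is a pencil sum. -/
theorem exists_eq_pencilSum_of_factor (n : ℕ) (Z φ : Module.End O L)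
    (h : ∃ (S : L →ₗ[O] (Fin (n + 1) → F)) (T : (Fin (n + 1) → F) →ₗ[O] L),
      (∀ l, S (Z l) = shift O n (S l)) ∧ (∀ v, T (shift O n v) = Z (T v)) ∧ T ∘ₗ S = φ) :
    ∃ σ : Module.End O L, φ = pencilSum n Z σ := by
  obtain ⟨S, T, hS, hT, rfl⟩ := h
  exact ⟨_, comp_eq_pencilSum n Z S T hS hT⟩

/-! ## Higman's criterion, "if": every pencil sum factors through `B ⊗_O L` -/

/-- **"If".**  When `Z ^ (n+1) = 0`, the pencil sum of any `σ` factors `B`-linearly through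
`(Fin (n+1) → L, shift)`: `S l = (σ Zⁿ⁻ᵏ l)ₖ`, `T v = Σₖ Zᵏ vₖ`. -/
theorem exists_factor_of_pencilSum (n : ℕ) (Z σ : Module.End O L) (hZ : Z ^ (n + 1) = 0) :
    ∃ (S : L →ₗ[O] (Fin (n + 1) → L)) (T : (Fin (n + 1) → L) →ₗ[O] L),
      (∀ l, S (Z l) = shift O n (S l)) ∧ (∀ v, T (shift O n v) = Z (T v)) ∧
        T ∘ₗ S = pencilSum n Z σ := by
  refine ⟨LinearMap.pi (fun k : Fin (n + 1) => σ * Z ^ (n - k : ℕ)),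
    ∑ k : Fin (n + 1), (Z ^ (k : ℕ)) ∘ₗ LinearMap.proj k, ?_, ?_, ?_⟩
  · intro l
    funext k
    refine Fin.cases ?_ (fun j => ?_) k
    · simp only [LinearMap.pi_apply, Module.End.mul_apply, shift_apply_zero, Fin.val_zero,
        Nat.sub_zero]
      have h3 : (Z ^ n) (Z l) = (Z ^ (n + 1)) l := by
        rw [pow_succ, Module.End.mul_apply]
      rw [h3, hZ, LinearMap.zero_apply, map_zero]
    · simp only [LinearMap.pi_apply, Module.End.mul_apply, shift_apply_succ, Fin.val_succ,
        Fin.val_castSucc]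
      have h2 : n - (j : ℕ) = (n - ((j : ℕ) + 1)) + 1 := by
        have := j.isLt
        omega
      rw [h2, pow_succ, Module.End.mul_apply]
  · intro v
    have hL : (∑ k : Fin (n + 1), (Z ^ (k : ℕ)) ∘ₗ LinearMap.proj k) (shift O n v)
        = ∑ j : Fin n, (Z ^ ((j : ℕ) + 1)) (v (Fin.castSucc j)) := by
      rw [LinearMap.sum_apply, Fin.sum_univ_succ]
      simp [LinearMap.comp_apply, Fin.val_succ]
    have hR : Z ((∑ k : Fin (n + 1), (Z ^ (k : ℕ)) ∘ₗ LinearMap.proj k) v)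
        = ∑ j : Fin n, (Z ^ ((j : ℕ) + 1)) (v (Fin.castSucc j)) := by
      rw [LinearMap.sum_apply, map_sum, Fin.sum_univ_castSucc]
      simp only [LinearMap.comp_apply, LinearMap.proj_apply, Fin.val_castSucc, Fin.val_last]
      have h3 : Z ((Z ^ n) (v (Fin.last n))) = 0 := by
        rw [← Module.End.mul_apply, ← pow_succ', hZ, LinearMap.zero_apply]
      rw [h3, add_zero]
      refine Finset.sum_congr rfl (fun j _ => ?_)
      rw [pow_succ', Module.End.mul_apply]
    rw [hL, hR]
  · apply LinearMap.ext
    intro l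
    simp [pencilSum, LinearMap.sum_apply, Module.End.mul_apply]

/-! ## Calibration (KEPT): the Jacobian power `zⁿ` is a pencil sum when `n+1` is invertible -/

/-- Calibration: `pencilSum n Z (c • 1) = ((n+1) c) • Zⁿ` (all `n+1` terms equal `c • Zⁿ`). -/
theorem pencilSum_smul_one (n : ℕ) (Z : Module.End O L) (c : O) :
    pencilSum n Z (c • (1 : Module.End O L)) = (((n + 1 : ℕ) : O) * c) • Z ^ n := by
  unfold pencilSum
  have h : ∀ k ∈ (Finset.univ : Finset (Fin (n + 1))),
      Z ^ (k : ℕ) * (c • (1 : Module.End O L)) * Z ^ (n - k : ℕ) = c • Z ^ n := by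
    intro k _
    rw [mul_smul_comm, mul_one, smul_mul_assoc, ← pow_add,
      Nat.add_sub_of_le (Nat.lt_succ_iff.mp k.isLt)]
  rw [Finset.sum_congr rfl h, Finset.sum_const, Finset.card_univ, Fintype.card_fin,
    ← Nat.cast_smul_eq_nsmul O, smul_smul]

/-- `Euler`: if `(n+1) u = 1` in `O` then `Zⁿ = pencilSum n Z (u • 1)`; with
`exists_factor_of_pencilSum` this says `zⁿ · 1_L` factors through `B ⊗ L` for EVERY `(L, Z)`,
`Z ^ (n+1) = 0` — the element `zⁿ ∈ jac(z ^ (n+1))` is never lost. -/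
theorem pow_eq_pencilSum_of_mul_eq_one (n : ℕ) (Z : Module.End O L) (u : O)
    (hu : ((n + 1 : ℕ) : O) * u = 1) : Z ^ n = pencilSum n Z (u • 1) := by
  rw [pencilSum_smul_one, hu, one_smul]

/-- **KEPT without Euler.**  If `σ ∘ Z = 0` and `Zᵐ ∘ σ = Zᵐ` then `pencilSum m Z σ = Zᵐ` (only the `k = m`
term survives).  Over a PID `O`, for a lattice `(L, Z)` (`L` free of finite rank, `Z ^ (m+1) = 0`) such a `σ`
always exists: `σ = 1 - π` with `π` a projection of `L` onto the saturation `C` of `im Z` — a direct summand,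
and `C ⊆ ker Zᵐ` because `wʲx ∈ im Z ⇒ wʲ Zᵐ x ∈ im Z^(m+1) = 0`.  Hence `zᵐ · 1` is stably zero on every
lattice in EVERY characteristic, including `p ∣ m+1` where `zᵐ ∉ jac(xy - z^(m+1)) = (x, y)` (paper remark,
not formalised here: the KEPT row `zᵐ` of the loss law does not depend on the Jacobian ideal). -/
theorem pencilSum_eq_pow (m : ℕ) (Z σ : Module.End O L) (h1 : σ * Z = 0) (h2 : Z ^ m * σ = Z ^ m) :
    pencilSum m Z σ = Z ^ m := by
  unfold pencilSum
  rw [Fin.sum_univ_castSucc]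
  simp only [Fin.val_castSucc, Fin.val_last, Nat.sub_self, pow_zero, mul_one]
  rw [h2]
  have h : ∀ j ∈ (Finset.univ : Finset (Fin m)), Z ^ (j : ℕ) * σ * Z ^ (m - j : ℕ) = 0 := by
    intro j _
    have h3 : m - (j : ℕ) = (m - (j : ℕ) - 1) + 1 := by
      have := j.isLt
      omega
    rw [h3, pow_succ', ← mul_assoc, mul_assoc (Z ^ (j : ℕ)), h1, mul_zero, zero_mul]
  rw [Finset.sum_congr rfl h, Finset.sum_const_zero, zero_add]

/-! ## LOST: the chain obstruction -/

/-- Pencil sums for `Z = w • N` are divisible by `wⁿ` (here `n = m`). -/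
theorem pencilSum_smul (m : ℕ) (N g : Module.End O L) (w : O) :
    pencilSum m (w • N) g = w ^ m • ∑ k : Fin (m + 1), N ^ (k : ℕ) * g * N ^ (m - k : ℕ) := by
  unfold pencilSum
  rw [Finset.smul_sum]
  refine Finset.sum_congr rfl (fun k _ => ?_)
  rw [smul_pow, smul_pow, smul_mul_assoc, smul_mul_assoc, mul_smul_comm, smul_smul, ← pow_add,
    Nat.add_sub_of_le (Nat.lt_succ_iff.mp k.isLt)]

/-- **Divisibility obstruction.**  If some matrix coefficient of `Nᵉ` is `1` and `wᵉ ∉ wᵐ O`, then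
`(w • N)ᵉ` is not a pencil sum for the exponent `m` (no nilpotency needed). -/
theorem pencilSum_ne_pow {V : Type*} [AddCommGroup V] [Module O V] (m e : ℕ) (N : Module.End O V)
    (w : O) (v : V) (lam : V →ₗ[O] O) (hv : lam ((N ^ e) v) = 1)
    (hw : ∀ c : O, w ^ e ≠ w ^ m * c) (g : Module.End O V) :
    pencilSum m (w • N) g ≠ (w • N) ^ e := by
  intro h
  have h1 : lam (pencilSum m (w • N) g v) = lam (((w • N) ^ e) v) := by rw [h]
  rw [pencilSum_smul, LinearMap.smul_apply, map_smul, smul_pow, LinearMap.smul_apply, map_smul, hv,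
    smul_eq_mul, smul_eq_mul, mul_one] at h1
  exact hw _ h1.symm

/-- The unit chain is a `B`-module for `B = O[z]/(z^(n+1))` (a fortiori for `O[z]/(z^(n+2))`):
`(w • shift) ^ (n+1) = 0` on `O^(n+1)`. -/
theorem chain_pow_eq_zero (n : ℕ) (w : O) :
    (w • shift O n : Module.End O (Fin (n + 1) → O)) ^ (n + 1) = 0 := by
  rw [smul_pow, shift_pow_eq_zero, smul_zero]

/-- **The chain obstruction (all ranks).**  On the unit chain `(O^(n+1), Z = w • shift)` —
`Z eⱼ = w eⱼ₊₁` — the power `Zᵉ`, `e ≤ n`, is not a pencil sum for the exponent `n+1` as soon as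
`wᵉ ∉ wⁿ⁺¹ O`.  (`m = n+1`: «`zᵉ · 1`, `e ≤ m-1`, is not stably zero on the rank-`m` chain lattice over
`O[z]/(z^(m+1))`».) -/
theorem not_pencilSum_chain (n : ℕ) (w : O) (e : Fin (n + 1))
    (hw : ∀ c : O, w ^ (e : ℕ) ≠ w ^ (n + 1) * c) (g : Module.End O (Fin (n + 1) → O)) :
    pencilSum (n + 1) (w • shift O n) g ≠ (w • shift O n) ^ (e : ℕ) := by
  refine pencilSum_ne_pow (V := Fin (n + 1) → O) (n + 1) (e : ℕ) (shift O n) w (Pi.single 0 1)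
    (LinearMap.proj e) ?_ hw g
  rw [LinearMap.proj_apply, shift_pow_single_zero]
  exact Pi.single_eq_same _ _

/-- **Corollary (no free factorisation).**  Under the same hypothesis `Zᵉ` on the unit chain does not
factor `O[z]/(z^(n+2))`-linearly through ANY free module `(Fin (n+2) → F, shift)`; since projective
modules are summands of free ones, `zᵉ · 1` is not stably zero on the chain. -/
theorem chain_not_factor (n : ℕ) (w : O) (e : Fin (n + 1))
    (hw : ∀ c : O, w ^ (e : ℕ) ≠ w ^ (n + 1) * c)
    {F : Type*} [AddCommGroup F] [Module O F]
    (S : (Fin (n + 1) → O) →ₗ[O] (Fin (n + 2) → F)) (T : (Fin (n + 2) → F) →ₗ[O] (Fin (n + 1) → O))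
    (hS : ∀ l, S ((w • shift O n) l) = shift O (n + 1) (S l))
    (hT : ∀ v, T (shift O (n + 1) v) = (w • shift O n) (T v)) :
    T ∘ₗ S ≠ (w • shift O n) ^ (e : ℕ) := by
  rw [comp_eq_pencilSum (n + 1) (w • shift O n) S T hS hT]
  exact not_pencilSum_chain n w e hw _

/-- The hypothesis `wᵉ ∉ wⁿ⁺¹ O` holds for every `e ≤ n` when `O` is a domain and `w ≠ 0` is not a
unit (e.g. `O = k[w]`, `k⟦w⟧`, any DVR with uniformiser `w`). -/
theorem pow_ne_pow_mul [IsDomain O] (w : O) (hw0 : w ≠ 0) (hwu : ¬ IsUnit w) {e n : ℕ} (he : e ≤ n) :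
    ∀ c : O, w ^ e ≠ w ^ (n + 1) * c := by
  intro c h
  apply hwu
  have h' : w ^ e * 1 = w ^ e * (w ^ (n - e) * w * c) := by
    rw [mul_one, ← mul_assoc, ← pow_succ, ← pow_add, show e + (n - e + 1) = n + 1 by omega]
    exact h
  have h'' := mul_left_cancel₀ (pow_ne_zero e hw0) h'
  exact isUnit_iff_exists_inv.mpr ⟨w ^ (n - e) * c, by rw [h'']; ring⟩

end Summit.ResolutionOfSingularities.ResolutionOfSingularities.Theorems.HomologicalConductor.PersistencePencil
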